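import Summits.KontsevichZagierPeriods.Zeta5Search.TwoTaleP15LineBoundRate
import Summits.KontsevichZagierPeriods.Zeta5Search.TwoTaleRungALineBoundRate
import Summits.KontsevichZagierPeriods.Zeta5Search.TwoTaleLineBoundRC
import Summits.KontsevichZagierPeriods.Zeta5Search.Denom.TwoTaleL25Forms

/-!
# RUNG L(2/5) `(32,27,22,37 | 0,5,10,64)`: the scaled line bound `log ‖Rₙ‖ ≤ n·rateL25(η) + O(log n + log(484+η²))` on `x = ⌊127n/10⌋ + ½`

HONEST FRAMING: systematic search; no irrationality claim unless certified.  Cell pub-zeta5 (measure-opt g0), the L(2/5)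
twin of P1's `TwoTaleD1LineRate` (file T3 of the D1 programme).  No measure or irrationality claim: the real-variable
upper bound for the modulus of Zudilin's rational function `Rₙ(s) = Zudilin2014.RC (aL25 n) (bL25 n) s`
([Zudilin2014ZetaTwo, §3] at the cone point `a = (32n+1, 27n+1, 22n+1, 37n+1)`, `b = (1, 5n+1, 10n+1, 64n+2)`,
`a₂* = 27n+1`) on the vertical line `Re s = uₙ = xₙ + ½ − a₂*`, `xₙ = ⌊127n/10⌋` (the design abscissa `ξ = 127/10`:
the tale-1 saddle is at `ξ* = 12.70013`, `η* = 5.22958`, value `−71.44179775`; at `ξ = 127/10` the supremum is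
`−71.44179774`, a loss of `4·10⁻⁹` nats — `HOME/pub-zeta5-measure-opt/g0/design/`), written at height `Im s = nη`:
* `rateL25 η = Σ± prim η Vᵢ* + 39 + κ_L25`, `V* = (177, −143 | 127, −93 | 77, −43 ‖ 497, 227)/10`,
  `κ_L25 = 27 log 27 − 32 log 32 − 22 log 22 − 12 log 12`, `prim η V = V·½log(V²+η²) − V + η·arctan(V/η)`
  (P1's `TwoTaleLineBound.prim`);
* **`log_norm_RCL25_line_le`**: for `n ≥ 3`, `η ≠ 0`,
  `log ‖RC (aL25 n) (bL25 n) (uₙ + i·nη)‖ ≤ n·rateL25 η + 2·log n + 9·log(484 + η²) + K0L25`,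
  `K0L25 = 12|log 2| + 3(1+log 2) + 1 + 9 log 6` (the endpoint constants come with `log(52² + η²)`, which is
  absorbed by `log(52² + η²) ≤ log 6 + log(22² + η²)` so that the `dy`-assembly of `TwoTaleP15LineBoundDecay`
  (majorant `(484+y²)⁹e^{−δ|y|}`) applies verbatim).
Ingredients (all tree): P1's GENERAL block bound `log_norm_RC_le`, `prim_scale`/`halfLog_scale`, the general endpoint
lemmas `prim_endpoint_gen` (`m = 2`, `M = 52`) and `halfLog_endpoint_gen`, `log_factorial_two_sided` (the `n log n` terms:
`+39 n log n` from the blocks against `−39 n log n` from `Π = (27n)!/((32n)!(22n)!(12n)!)`).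
What remains for `DecayL25 c`: the certificate `∀ η ≠ 0, rateL25 η − (2π−δ)|η| ≤ M` (`TwoTaleL25LineProfileShape`,
`TwoTaleL25LineCertificate`; numerically `sup = −71.44179774` at `η = ±5.2296`) and the `dy`-assembly (`TwoTaleL25Decay`).
-/

noncomputable section

open Real Complex
open Literature.NumberTheory.Irrationality.Zudilin2014
open Summit.KontsevichZagierPeriods.Zeta5Search.Denom.TwoTaleL25Forms
open Summit.KontsevichZagierPeriods.Zeta5Search.TwoTaleLineBound

namespace Summit.KontsevichZagierPeriods.Zeta5Search.TwoTaleL25Line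

/-- The abscissa `xₙ = ⌊127n/10⌋` (design line `ξ = 127/10`, loss `4·10⁻⁹` nats against the saddle `ξ* = 12.70013`). -/
def xLineL25 (n : ℕ) : ℕ := 127 * n / 10

/-- `uₙ = xₙ + ½ − (27n+1)`, the real part of the argument of `Rₙ` on the line. -/
def uLineL25 (n : ℕ) : ℝ := (xLineL25 n : ℝ) + 1 / 2 - (27 * n + 1)

/-- The entropy row `κ_L25 = 27 log 27 − 32 log 32 − 22 log 22 − 12 log 12` of `Π = (27n)!/((32n)!(22n)!(12n)!)`. -/
def kappaL25 : ℝ := 27 * Real.log 27 - 32 * Real.log 32 - 22 * Real.log 22 - 12 * Real.log 12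

/-- **The L(2/5) rate function** `rateL25 η = Σ± prim η Vᵢ* + 39 + κ_L25`. -/
def rateL25 (η : ℝ) : ℝ :=
  (prim η (177 / 10) - prim η (-143 / 10)) + (prim η (127 / 10) - prim η (-93 / 10))
    + (prim η (77 / 10) - prim η (-43 / 10)) - (prim η (497 / 10) - prim η (227 / 10)) + 39 + kappaL25

/-- The Lipschitz constant of `prim η ·` on `2 ≤ |W| ≤ 52`. -/
def lipKL25 (η : ℝ) : ℝ := |Real.log 2| + Real.log (52 ^ 2 + η ^ 2) / 2

/-- The constant `K0L25 = 12|log 2| + 3(1 + log 2) + 1 + 9 log 6` of the line bound. -/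
def K0L25 : ℝ := 12 * |Real.log 2| + 3 * (1 + Real.log 2) + 1 + 9 * Real.log 6

/-- `xₙ ≤ 22n` (the line lies in the strip-shift range of `TwoTaleL25StripShift`). -/
theorem xLineL25_le (n : ℕ) : xLineL25 n ≤ 22 * n := by
  unfold xLineL25
  omega

/-- Floor bookkeeping: `−3/2 ≤ uₙ + 143n/10 ≤ −1/2`. -/
theorem uLineL25_bounds (n : ℕ) : -3 / 2 ≤ uLineL25 n + 143 * n / 10 ∧ uLineL25 n + 143 * n / 10 ≤ -1 / 2 := by
  unfold uLineL25 xLineL25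
  have h1 : 10 * (127 * n / 10) ≤ 127 * n := Nat.mul_div_le _ _
  have h2 : 127 * n < 10 * (127 * n / 10) + 10 := by omega
  have h1' : (10 : ℝ) * ((127 * n / 10 : ℕ) : ℝ) ≤ 127 * n := by exact_mod_cast h1
  have h2' : (127 : ℝ) * n < 10 * ((127 * n / 10 : ℕ) : ℝ) + 10 := by exact_mod_cast h2
  constructor <;> linarith

variable {η : ℝ}

/-- `lipKL25 η ≥ 0`. -/
theorem lipKL25_nonneg (η : ℝ) : 0 ≤ lipKL25 η := by
  unfold lipKL25
  have : 0 ≤ Real.log (52 ^ 2 + η ^ 2) := Real.log_nonneg (by nlinarith [sq_nonneg η])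
  positivity

/-- **Endpoint transfer at L(2/5)**: an endpoint `E` with `|E − nV*| ≤ 3/2`, `5/2 ≤ |V*| ≤ 497/10`, satisfies
`|prim (nη) E − (n·prim η V* + E·log n)| ≤ (3/2)·lipKL25 η` (`n ≥ 3`, `η ≠ 0`: the general lemma
`prim_endpoint_gen` with `m = 2`, `M = 52`). -/
theorem prim_endpointL25 (hη : η ≠ 0) {n : ℕ} (hn : 3 ≤ n) {E Vs : ℝ} (hE : |E - n * Vs| ≤ 3 / 2)
    (hV1 : 5 / 2 ≤ |Vs|) (hV2 : |Vs| ≤ 497 / 10) :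
    |prim (n * η) E - (n * prim η Vs + E * Real.log n)| ≤ 3 / 2 * lipKL25 η := by
  have hn1 : 1 ≤ n := by omega
  have hn3 : (3 : ℝ) ≤ n := by exact_mod_cast hn
  have hn0 : (0 : ℝ) < n := by linarith
  have hlow : (2 : ℝ) + 3 / (2 * n) ≤ |Vs| := by
    have : (3 : ℝ) / (2 * n) ≤ 1 / 2 := by
      rw [div_le_iff₀ (by positivity)]; linarith
    linarith
  have h := prim_endpoint_gen hη hn1 (m := 2) (M := 52) (by norm_num) (by norm_num) hE hlow (by linarith)
  unfold lipKL25
  exact h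

/-- A numerator endpoint halfLog term at L(2/5): `|E| ≤ 52n` gives `halfLog (nη) E ≤ log n + lipKL25 η − |log 2|`. -/
theorem halfLog_endpointL25 (hη : η ≠ 0) {n : ℕ} (hn : 1 ≤ n) {E : ℝ} (hE : |E| ≤ 52 * n) :
    halfLog (n * η) E ≤ Real.log n + Real.log (52 ^ 2 + η ^ 2) / 2 :=
  halfLog_endpoint_gen hη hn (by norm_num) hE

/-! ### Stirling for `Π = (27n)!/((32n)!(22n)!(12n)!)` -/

/-- `Π` at L(2/5) as factorials: `Pi (aL25 n) (bL25 n) = (27n)!/((32n)!(22n)!(12n)!)`. -/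
theorem PiL25_eq (n : ℕ) : Pi (aL25 n) (bL25 n) =
    ((27 * n).factorial : ℚ) / (((32 * n).factorial : ℚ) * ((22 * n).factorial : ℚ) * ((12 * n).factorial : ℚ)) := by
  have e3 : (bL25 n 3 - aL25 n 3 - 1).toNat = 27 * n := by rw [aL25_three, bL25_three]; omega
  have e0 : (aL25 n 0 - bL25 n 0).toNat = 32 * n := by rw [aL25_zero, bL25_zero]; omega
  have e1 : (aL25 n 1 - bL25 n 1).toNat = 22 * n := by rw [aL25_one, bL25_one]; omega
  have e2 : (aL25 n 2 - bL25 n 2).toNat = 12 * n := by rw [aL25_two, bL25_two]; omega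
  unfold Pi numFac facZ
  rw [e0, e1, e2, e3]

/-- `log |Π| = log (27n)! − log (32n)! − log (22n)! − log (12n)!`. -/
theorem log_abs_PiL25 (n : ℕ) : Real.log |((Pi (aL25 n) (bL25 n) : ℚ) : ℝ)| =
    Real.log ((27 * n).factorial : ℝ) - Real.log ((32 * n).factorial : ℝ) - Real.log ((22 * n).factorial : ℝ)
      - Real.log ((12 * n).factorial : ℝ) := by
  rw [PiL25_eq]
  push_cast
  have h : ∀ k : ℕ, (0 : ℝ) < (k.factorial : ℝ) := fun k => by exact_mod_cast Nat.factorial_pos k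
  rw [abs_of_pos (div_pos (h _) (mul_pos (mul_pos (h _) (h _)) (h _))),
    Real.log_div (h _).ne' (mul_pos (mul_pos (h _) (h _)) (h _)).ne',
    Real.log_mul (mul_pos (h _) (h _)).ne' (h _).ne', Real.log_mul (h _).ne' (h _).ne']
  ring

/-- **Stirling for `log |Π|`**: `log |Π| ≤ −39·n log n + n·κ_L25 + 39n − log n + 1` (`n ≥ 1`). -/
theorem log_abs_PiL25_le {n : ℕ} (hn : 1 ≤ n) :
    Real.log |((Pi (aL25 n) (bL25 n) : ℚ) : ℝ)| ≤ -39 * (n * Real.log n) + n * kappaL25 + 39 * n - Real.log n + 1 := by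
  have hn0 : (0 : ℝ) < n := by exact_mod_cast hn
  rw [log_abs_PiL25]
  have c27 : Real.log ((27 * n : ℕ) : ℝ) = Real.log 27 + Real.log n := by
    push_cast; exact Real.log_mul (by norm_num) hn0.ne'
  have c32 : Real.log ((32 * n : ℕ) : ℝ) = Real.log 32 + Real.log n := by
    push_cast; exact Real.log_mul (by norm_num) hn0.ne'
  have c22 : Real.log ((22 * n : ℕ) : ℝ) = Real.log 22 + Real.log n := by
    push_cast; exact Real.log_mul (by norm_num) hn0.ne'
  have c12 : Real.log ((12 * n : ℕ) : ℝ) = Real.log 12 + Real.log n := by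
    push_cast; exact Real.log_mul (by norm_num) hn0.ne'
  have s27 := (log_factorial_two_sided (n := 27 * n) (by omega)).2
  have s32 := (log_factorial_two_sided (n := 32 * n) (by omega)).1
  have s22 := (log_factorial_two_sided (n := 22 * n) (by omega)).1
  have s12 := (log_factorial_two_sided (n := 12 * n) (by omega)).1
  rw [c27] at s27; rw [c32] at s32; rw [c22] at s22; rw [c12] at s12
  simp only [Nat.cast_mul, Nat.cast_ofNat] at s27 s32 s22 s12
  have q27 : (27 * (n : ℝ)) * (Real.log 27 + Real.log n) = 27 * (n * Real.log 27) + 27 * (n * Real.log n) := by ring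
  have q32 : (32 * (n : ℝ)) * (Real.log 32 + Real.log n) = 32 * (n * Real.log 32) + 32 * (n * Real.log n) := by ring
  have q22 : (22 * (n : ℝ)) * (Real.log 22 + Real.log n) = 22 * (n * Real.log 22) + 22 * (n * Real.log n) := by ring
  have q12 : (12 * (n : ℝ)) * (Real.log 12 + Real.log n) = 12 * (n * Real.log 12) + 12 * (n * Real.log n) := by ring
  have hκ : (n : ℝ) * kappaL25 =
      27 * (n * Real.log 27) - 32 * (n * Real.log 32) - 22 * (n * Real.log 22) - 12 * (n * Real.log 12) := by
    unfold kappaL25; ring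
  have hlog2732 : Real.log 27 ≤ Real.log 32 := Real.log_le_log (by norm_num) (by norm_num)
  have hlog22 : 0 ≤ Real.log 22 := Real.log_nonneg (by norm_num)
  have hlog12 : 0 ≤ Real.log 12 := Real.log_nonneg (by norm_num)
  rw [hκ]
  linarith

/-! ### The line bound -/

set_option maxHeartbeats 400000 in
/-- **The scaled line bound at L(2/5)**: for `n ≥ 3`, `η ≠ 0`,
`log ‖RC (aL25 n) (bL25 n) (uₙ + i·nη)‖ ≤ n·rateL25 η + 2 log n + 9 log(22² + η²) + K0L25`. -/
theorem log_norm_RCL25_line_le (hη : η ≠ 0) {n : ℕ} (hn : 3 ≤ n) :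
    Real.log ‖RC (aL25 n) (bL25 n) ((uLineL25 n : ℂ) + (((n : ℝ) * η : ℝ) : ℂ) * I)‖ ≤
      n * rateL25 η + 2 * Real.log n + 9 * Real.log (22 ^ 2 + η ^ 2) + K0L25 := by
  have hnN : 1 ≤ n := by omega
  have hn0 : (0 : ℝ) < n := by exact_mod_cast (show 0 < n by omega)
  have hn1 : (1 : ℝ) ≤ n := by exact_mod_cast hnN
  have hn3 : (3 : ℝ) ≤ n := by exact_mod_cast hn
  have hy : (n : ℝ) * η ≠ 0 := mul_ne_zero hn0.ne' hη
  obtain ⟨hu1, hu2⟩ := uLineL25_bounds n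
  set u : ℝ := uLineL25 n with hu
  -- the general block bound, instantiated at L(2/5)
  have hlen : ∀ j : Fin 4, j ≠ 3 → bL25 n j + 2 ≤ aL25 n j := by
    intro j hj
    fin_cases j <;> simp at hj ⊢ <;> omega
  have hden : aL25 n 3 < bL25 n 3 := by rw [aL25_three, bL25_three]; omega
  have c3a : ((aL25 n 3 : ℤ) : ℝ) = 37 * n + 1 := by rw [aL25_three]; push_cast; ring
  have hu' : 1 ≤ u + ((aL25 n 3 : ℤ) : ℝ) := by rw [c3a]; linarith
  have hB := log_norm_RC_le hy hlen hden hu'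
  have c0 : ((aL25 n 0 - 1 : ℤ) : ℝ) = 32 * n := by rw [aL25_zero]; push_cast; ring
  have c0b : ((bL25 n 0 : ℤ) : ℝ) = 1 := by simp
  have c1 : ((aL25 n 1 - 1 : ℤ) : ℝ) = 27 * n := by rw [aL25_one]; push_cast; ring
  have c1b : ((bL25 n 1 : ℤ) : ℝ) = 5 * n + 1 := by rw [bL25_one]; push_cast; ring
  have c2 : ((aL25 n 2 - 1 : ℤ) : ℝ) = 22 * n := by rw [aL25_two]; push_cast; ring
  have c2b : ((bL25 n 2 : ℤ) : ℝ) = 10 * n + 1 := by rw [bL25_two]; push_cast; ring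
  have c3 : ((bL25 n 3 - 1 : ℤ) : ℝ) = 64 * n + 1 := by rw [bL25_three]; push_cast; ring
  rw [c0, c0b, c1, c1b, c2, c2b, c3, c3a] at hB
  -- the eight endpoints
  have a1 : (5:ℝ) / 2 ≤ |(177:ℝ) / 10| ∧ |(177:ℝ) / 10| ≤ 497 / 10 := by rw [abs_of_pos (by norm_num)]; norm_num
  have a2 : (5:ℝ) / 2 ≤ |(-143:ℝ) / 10| ∧ |(-143:ℝ) / 10| ≤ 497 / 10 := by rw [abs_of_neg (by norm_num)]; norm_num
  have a3 : (5:ℝ) / 2 ≤ |(127:ℝ) / 10| ∧ |(127:ℝ) / 10| ≤ 497 / 10 := by rw [abs_of_pos (by norm_num)]; norm_num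
  have a4 : (5:ℝ) / 2 ≤ |(-93:ℝ) / 10| ∧ |(-93:ℝ) / 10| ≤ 497 / 10 := by rw [abs_of_neg (by norm_num)]; norm_num
  have a5 : (5:ℝ) / 2 ≤ |(77:ℝ) / 10| ∧ |(77:ℝ) / 10| ≤ 497 / 10 := by rw [abs_of_pos (by norm_num)]; norm_num
  have a6 : (5:ℝ) / 2 ≤ |(-43:ℝ) / 10| ∧ |(-43:ℝ) / 10| ≤ 497 / 10 := by rw [abs_of_neg (by norm_num)]; norm_num
  have a7 : (5:ℝ) / 2 ≤ |(497:ℝ) / 10| ∧ |(497:ℝ) / 10| ≤ 497 / 10 := by rw [abs_of_pos (by norm_num)]; norm_num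
  have a8 : (5:ℝ) / 2 ≤ |(227:ℝ) / 10| ∧ |(227:ℝ) / 10| ≤ 497 / 10 := by rw [abs_of_pos (by norm_num)]; norm_num
  obtain ⟨e1a, e1b⟩ := abs_le.1 (prim_endpointL25 hη hn (E := u + 32 * n) (Vs := 177 / 10)
    (by rw [abs_le]; constructor <;> linarith) a1.1 a1.2)
  obtain ⟨e2a, e2b⟩ := abs_le.1 (prim_endpointL25 hη hn (E := u + 1) (Vs := -143 / 10)
    (by rw [abs_le]; constructor <;> linarith) a2.1 a2.2)
  obtain ⟨e3a, e3b⟩ := abs_le.1 (prim_endpointL25 hη hn (E := u + 27 * n) (Vs := 127 / 10)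
    (by rw [abs_le]; constructor <;> linarith) a3.1 a3.2)
  obtain ⟨e4a, e4b⟩ := abs_le.1 (prim_endpointL25 hη hn (E := u + (5 * n + 1)) (Vs := -93 / 10)
    (by rw [abs_le]; constructor <;> linarith) a4.1 a4.2)
  obtain ⟨e5a, e5b⟩ := abs_le.1 (prim_endpointL25 hη hn (E := u + 22 * n) (Vs := 77 / 10)
    (by rw [abs_le]; constructor <;> linarith) a5.1 a5.2)
  obtain ⟨e6a, e6b⟩ := abs_le.1 (prim_endpointL25 hη hn (E := u + (10 * n + 1)) (Vs := -43 / 10)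
    (by rw [abs_le]; constructor <;> linarith) a6.1 a6.2)
  obtain ⟨e7a, e7b⟩ := abs_le.1 (prim_endpointL25 hη hn (E := u + (64 * n + 1)) (Vs := 497 / 10)
    (by rw [abs_le]; constructor <;> linarith) a7.1 a7.2)
  obtain ⟨e8a, e8b⟩ := abs_le.1 (prim_endpointL25 hη hn (E := u + (37 * n + 1) - 1) (Vs := 227 / 10)
    (by rw [abs_le]; constructor <;> linarith) a8.1 a8.2)
  -- the six endpoint halfLog terms
  have l1 := halfLog_endpointL25 hη hnN (E := u + 1) (by rw [abs_le]; constructor <;> linarith)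
  have l2 := halfLog_endpointL25 hη hnN (E := u + 32 * n) (by rw [abs_le]; constructor <;> linarith)
  have l3 := halfLog_endpointL25 hη hnN (E := u + (5 * n + 1)) (by rw [abs_le]; constructor <;> linarith)
  have l4 := halfLog_endpointL25 hη hnN (E := u + 27 * n) (by rw [abs_le]; constructor <;> linarith)
  have l5 := halfLog_endpointL25 hη hnN (E := u + (10 * n + 1)) (by rw [abs_le]; constructor <;> linarith)
  have l6 := halfLog_endpointL25 hη hnN (E := u + 22 * n) (by rw [abs_le]; constructor <;> linarith)
  -- Stirling
  have hP := log_abs_PiL25_le hnN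
  have hlogn : 0 ≤ Real.log n := Real.log_nonneg hn1
  -- `log (52² + η²) ≤ log 6 + log (22² + η²)` (absorbs the wider Lipschitz range into the P15 majorant)
  have hlog52 : Real.log (52 ^ 2 + η ^ 2) ≤ Real.log 6 + Real.log (22 ^ 2 + η ^ 2) := by
    have hη2 : 0 ≤ η ^ 2 := sq_nonneg η
    have h' : (52 : ℝ) ^ 2 + η ^ 2 ≤ 6 * (22 ^ 2 + η ^ 2) := by norm_num; linarith
    rw [← Real.log_mul (by norm_num) (by positivity)]
    exact Real.log_le_log (by positivity) h'
  -- linearise the products (each product is an atom for `linarith`)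
  have p1 : (u + 32 * n) * Real.log n = u * Real.log n + 32 * (n * Real.log n) := by ring
  have p2 : (u + 1) * Real.log n = u * Real.log n + Real.log n := by ring
  have p3 : (u + 27 * n) * Real.log n = u * Real.log n + 27 * (n * Real.log n) := by ring
  have p4 : (u + (5 * n + 1)) * Real.log n = u * Real.log n + 5 * (n * Real.log n) + Real.log n := by ring
  have p5 : (u + 22 * n) * Real.log n = u * Real.log n + 22 * (n * Real.log n) := by ring
  have p6 : (u + (10 * n + 1)) * Real.log n = u * Real.log n + 10 * (n * Real.log n) + Real.log n := by ring
  have p7 : (u + (64 * n + 1)) * Real.log n = u * Real.log n + 64 * (n * Real.log n) + Real.log n := by ring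
  have p8 : (u + (37 * n + 1) - 1) * Real.log n = u * Real.log n + 37 * (n * Real.log n) := by ring
  have hG : (n : ℝ) * rateL25 η = n * prim η (177 / 10) - n * prim η (-143 / 10)
      + (n * prim η (127 / 10) - n * prim η (-93 / 10))
      + (n * prim η (77 / 10) - n * prim η (-43 / 10)) - (n * prim η (497 / 10) - n * prim η (227 / 10)) + 39 * n
      + n * kappaL25 := by
    unfold rateL25; ring
  have hKdef : lipKL25 η = |Real.log 2| + Real.log (52 ^ 2 + η ^ 2) / 2 := rfl
  have hK0 : K0L25 = 12 * |Real.log 2| + 3 * (1 + Real.log 2) + 1 + 9 * Real.log 6 := rfl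
  rw [hG, hK0]
  rw [p1] at e1b; rw [p2] at e2a; rw [p3] at e3b; rw [p4] at e4a; rw [p5] at e5b; rw [p6] at e6a
  rw [p7] at e7a; rw [p8] at e8b
  rw [hKdef] at e1b e2a e3b e4a e5b e6a e7a e8b
  clear e1a e2b e3a e4b e5a e6b e7b e8a p1 p2 p3 p4 p5 p6 p7 p8 a1 a2 a3 a4 a5 a6 a7 a8
  -- assemble in linear steps (keeps each `linarith` small); the final `set`s name the atoms so that
  -- `linarith` sees syntactically identical terms on both sides
  have step1 : prim (n * η) (u + 32 * n) - prim (n * η) (u + 1)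
      + (prim (n * η) (u + 27 * n) - prim (n * η) (u + (5 * n + 1)))
      + (prim (n * η) (u + 22 * n) - prim (n * η) (u + (10 * n + 1)))
      - (prim (n * η) (u + (64 * n + 1)) - prim (n * η) (u + (37 * n + 1) - 1)) ≤
      (n * prim η (177 / 10) - n * prim η (-143 / 10) + (n * prim η (127 / 10) - n * prim η (-93 / 10))
        + (n * prim η (77 / 10) - n * prim η (-43 / 10)) - (n * prim η (497 / 10) - n * prim η (227 / 10)))
      + 39 * (n * Real.log n) - 4 * Real.log n + 12 * (|Real.log 2| + Real.log (52 ^ 2 + η ^ 2) / 2) := by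
    linarith [e1b, e2a, e3b, e4a, e5b, e6a, e7a, e8b]
  have step2 := add_le_add (add_le_add (add_le_add (add_le_add (add_le_add l1 l2) l3) l4) l5) l6
  have hfin : Real.log ‖RC (aL25 n) (bL25 n) ((u : ℂ) + (((n : ℝ) * η : ℝ) : ℂ) * I)‖ ≤
      (n * prim η (177 / 10) - n * prim η (-143 / 10) + (n * prim η (127 / 10) - n * prim η (-93 / 10))
        + (n * prim η (77 / 10) - n * prim η (-43 / 10)) - (n * prim η (497 / 10) - n * prim η (227 / 10)))
      + n * kappaL25 + 39 * n + Real.log n + 12 * |Real.log 2| + 3 * (1 + Real.log 2) + 1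
      + 9 * Real.log (52 ^ 2 + η ^ 2) := by
    linarith [hB, step1, step2, hP]
  set L22 := Real.log (22 ^ 2 + η ^ 2) with hL22
  set L52 := Real.log (52 ^ 2 + η ^ 2) with hL52
  set LN := Real.log (n : ℝ) with hLN
  set LR := Real.log ‖RC (aL25 n) (bL25 n) ((u : ℂ) + (((n : ℝ) * η : ℝ) : ℂ) * I)‖ with hLR
  set S := (n * prim η (177 / 10) - n * prim η (-143 / 10) + (n * prim η (127 / 10) - n * prim η (-93 / 10))
        + (n * prim η (77 / 10) - n * prim η (-43 / 10)) - (n * prim η (497 / 10) - n * prim η (227 / 10)))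
    with hS
  set NK := (n : ℝ) * kappaL25 with hNK
  set L2 := Real.log 2 with hL2
  set L6 := Real.log 6 with hL6
  linarith only [hfin, hlogn, hlog52, abs_nonneg L2]


end Summit.KontsevichZagierPeriods.Zeta5Search.TwoTaleL25Line

end
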